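import Summits.QuantumFields.YangMills.Theorems.BackwardLiouvilleRigidityFlatRatioTerminationWindowTV
import HarnessLib

/-!
# THE SINGLE-HEIGHT TOTAL-VARIATION BOUND FROM AN INNER-WINDOW SUP-OSCILLATION (TN-OSC's consumer brick «WindowTV-osc»; v18 ULC re-key)

Cell `ym3-torus` (YM ladder rung R3 = continuum `SU(2)` Yang–Mills on the three-torus — a RUNG, NOT d = 4, NOT infinite volume, NOT a mass
gap, NOT Clay).  LEAD-20520 width seat `ym-ust-20520-w3` (gen 24); `--supports stmt-QuantumFields-20520 --as helper`, count-neutral,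
definition-free, default heartbeats; no registry, binder or `Lines/` edit (registered skeleton `Lines/semiclassical_s2beta.lean` v11.4, 0∕5,
★★OWNER RULING №36, untouched).

WHAT THIS IS.  Ideator `ym-r3-idea-1` g27 №2 (typing note TN-OSC, `Cruxes/…/GRAnchorFree.lean` 61fb5a22): the consumer of S3 + S4a in PATH B,
✓`FlatRatioTermination.stub_windowTV` (p647765; S4b `WindowTV` of `runpair_organ`), uses the one-bond oscillation `τ` and the inner-window chains of
length `≤ D` ONLY to derive `hstep1 : ∀ U ∈ inner window, U ∈ window ∧ |r U − r 1| ≤ δ₀` (its proof :115–127) — an inner-window SUP-OSCILLATION of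
the log-ratio RELATIVE TO THE FLAT CONFIGURATION; everything after never sees a bond.  Under v18 (O1ᵘ-H, Hessian currency, TN-ROOM∕TN-ANCHOR-FREE)
the junction `directTransport_supR` produces exactly such a sup-oscillation (telescope from the flat anchor along w4's chord paths to a gauge copy,
✓p797413 + ✓p794698), NOT a one-bond oscillation on the full window.  This file is the re-keyed consumer: ★★`windowTV_of_supOsc` = `stub_windowTV`
with the hypotheses `(D, τ·D ≤ δ₀, hchain, hosc)` REPLACED by `θin ≤ θ` and
`hosc1 : ∀ U, PlaqSmall θin U → |(log ρ U − log ρ′ U) − (log ρ 1 − log ρ′ 1)| ≤ τ`, `τ ≤ δ₀`; conclusion and `δ₀ = min (1∕2) (ε∕11)` unchanged;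
proof = the landed one from `hcmp` on, VERBATIM (all credit: the termination line's author; the two helper lemmas are imported BY NAME).  So the
ULC re-key of S4b under v18 is: feed S3ᴴ's conclusion (spec v1.5 (i): inner-window sup-oscillation relative to `1`) into this theorem — S4a leaves ULC.

WHAT THIS IS NOT: elementary measure theory; nothing of Bałaban's; S3ᴴ∕O1ᵘ-H∕crux 20520∕`YM3TorusSU2` NOT proved; no summit is proved by a helper.
R3 = SU(2) YM₃ on T³ — NOT d = 4, NOT infinite volume, NOT a mass gap, NOT Clay; the Yang–Mills mass gap is NOT proved.
-/

set_option autoImplicit false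

open MeasureTheory Filter Topology
open Literature.MathematicalPhysics.QuantumFieldTheory.Balaban1983to89 T3ContinuumYM3Torus T3NestedUnitLaws
  T3UnitLawDensityEML T4Continuum BalabanUVClass T3UnitScaleTilt
open Summit.QuantumFields.YangMills.Theorems.FlatRatioTermination (measureReal_le_mul_of_density_le exp_two_mul_div_sub_one_le)

namespace Summit.QuantumFields.YangMills.Theorems.RunPairOrganWindowTVOfSupOsc

/-- ★★ **WINDOW TOTAL VARIATION FROM AN INNER-WINDOW SUP-OSCILLATION** (TN-OSC consumer; `stub_windowTV` re-keyed): at one height, `μ = Haar·ρ`,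
`μ′ = Haar·ρ′` probability laws with `ρ, ρ′ > 0` on the window `{PlaqSmall θ}`, an inner window `{PlaqSmall θin}`, `θin ≤ θ`, on which the log-ratio
`log ρ − log ρ′` is within `τ ≤ δ₀` of its value at the flat configuration `1`, and inner tails `≤ ηr ≤ δ₀` under both laws ⇒ `|μ A − μ′ A| ≤ ε`
for every measurable `A` (`δ₀ = min (1∕2) (ε∕11)`). [folklore] -/
theorem windowTV_of_supOsc : ∀ ε : ℝ, 0 < ε → ∃ δ₀ : ℝ, 0 < δ₀ ∧ ∀ (F : T3Family) (j : ℕ) (θin θ τ ηr : ℝ), 0 < θin → θin ≤ θ → 0 ≤ τ → τ ≤ δ₀ → 0 ≤ ηr → ηr ≤ δ₀ →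
    ∀ (μ μ' : MeasureTheory.Measure (GaugeField (F.P j) 0 ↥(Matrix.specialUnitaryGroup (Fin 2) ℂ)))
      (ρ ρ' : GaugeField (F.P j) 0 ↥(Matrix.specialUnitaryGroup (Fin 2) ℂ) → ℝ),
      IsProbabilityMeasure μ → IsProbabilityMeasure μ' → (∀ U, PlaqSmall θ U → 0 < ρ U ∧ 0 < ρ' U) →
      μ = (fieldMeasure _ _ _).withDensity (fun U => ENNReal.ofReal (ρ U)) → μ' = (fieldMeasure _ _ _).withDensity (fun U => ENNReal.ofReal (ρ' U)) →
      (∀ U : GaugeField (F.P j) 0 ↥(Matrix.specialUnitaryGroup (Fin 2) ℂ), PlaqSmall θin U →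
        |(Real.log (ρ U) - Real.log (ρ' U)) - (Real.log (ρ 1) - Real.log (ρ' 1))| ≤ τ) →
      μ {U | ¬ PlaqSmall θin U} ≤ ENNReal.ofReal ηr → μ' {U | ¬ PlaqSmall θin U} ≤ ENNReal.ofReal ηr →
      ∀ A : Set (GaugeField (F.P j) 0 ↥(Matrix.specialUnitaryGroup (Fin 2) ℂ)), MeasurableSet A → |μ.real A - μ'.real A| ≤ ε := by
  intro ε hε
  refine ⟨min (1 / 2) (ε / 11), lt_min (by norm_num) (by positivity), ?_⟩
  intro F j θin θ τ ηr _hθin hθle hτ hτδ hηr hηrδ μ μ' ρ ρ' hμP hμ'P hpos hμ hμ' hosc1 htail htail' A hA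
  set δ₀ : ℝ := min (1 / 2) (ε / 11) with hδ₀def
  have hδ₀half : δ₀ ≤ 1 / 2 := min_le_left _ _
  have hδ₀ε : δ₀ ≤ ε / 11 := min_le_right _ _
  have hδ₀nn : 0 ≤ δ₀ := hηr.trans hηrδ
  -- the window, the inner window, the log-ratio and its value at the trivial configuration
  set S : Set (GaugeField (F.P j) 0 ↥(Matrix.specialUnitaryGroup (Fin 2) ℂ)) := {U | PlaqSmall θ U} with hSdef
  set G : Set (GaugeField (F.P j) 0 ↥(Matrix.specialUnitaryGroup (Fin 2) ℂ)) := {U | PlaqSmall θin U} with hGdef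
  have hG : MeasurableSet G := T3UnitScaleTilt.measurableSet_plaqSmall θin
  set r : GaugeField (F.P j) 0 ↥(Matrix.specialUnitaryGroup (Fin 2) ℂ) → ℝ := fun U => Real.log (ρ U) - Real.log (ρ' U)
    with hrdef
  set r₁ : ℝ := Real.log (ρ 1) - Real.log (ρ' 1) with hr₁def
  -- §1 on the inner window: inside the window (`θin ≤ θ`), and the log-ratio is within `δ₀` of its value at `1` (hypothesis `hosc1`)
  have hstep1 : ∀ U ∈ G, U ∈ S ∧ |r U - r₁| ≤ δ₀ := by
    intro U hU
    exact ⟨fun p => lt_of_lt_of_le (hU p) hθle, (hosc1 U hU).trans hτδ⟩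
  -- §2 pointwise density comparison on the inner window
  set K₁ : ℝ := Real.exp (r₁ + δ₀) with hK₁def
  set K₂ : ℝ := Real.exp (δ₀ - r₁) with hK₂def
  have hK₁pos : 0 < K₁ := Real.exp_pos _
  have hK₂pos : 0 < K₂ := Real.exp_pos _
  have hK₁K₂ : K₁ * K₂ = Real.exp (2 * δ₀) := by
    rw [hK₁def, hK₂def, ← Real.exp_add]; ring_nf
  have hcmp : ∀ U ∈ G, ρ U ≤ K₁ * ρ' U ∧ ρ' U ≤ K₂ * ρ U := by
    intro U hU
    obtain ⟨hUS, hr⟩ := hstep1 U hU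
    obtain ⟨hρ, hρ'⟩ := hpos U hUS
    have hr' := abs_le.mp hr
    constructor
    · have : Real.log (ρ U) ≤ Real.log (ρ' U) + (r₁ + δ₀) := by
        have := hr'.2; simp only [hrdef] at this; linarith
      calc ρ U = Real.exp (Real.log (ρ U)) := (Real.exp_log hρ).symm
        _ ≤ Real.exp (Real.log (ρ' U) + (r₁ + δ₀)) := Real.exp_le_exp.mpr this
        _ = K₁ * ρ' U := by rw [Real.exp_add, Real.exp_log hρ', hK₁def, mul_comm]
    · have : Real.log (ρ' U) ≤ Real.log (ρ U) + (δ₀ - r₁) := by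
        have := hr'.1; simp only [hrdef] at this; linarith
      calc ρ' U = Real.exp (Real.log (ρ' U)) := (Real.exp_log hρ').symm
        _ ≤ Real.exp (Real.log (ρ U) + (δ₀ - r₁)) := Real.exp_le_exp.mpr this
        _ = K₂ * ρ U := by rw [Real.exp_add, Real.exp_log hρ, hK₂def, mul_comm]
  -- §3 integrated comparisons on `C ∩ G`
  have hint : ∀ C, MeasurableSet C → μ.real (C ∩ G) ≤ K₁ * μ'.real (C ∩ G) ∧ μ'.real (C ∩ G) ≤ K₂ * μ.real (C ∩ G) := by
    intro C hC
    exact ⟨measureReal_le_mul_of_density_le _ μ μ' ρ ρ' hμ hμ' (hC.inter hG) hK₁pos.le fun x hx => (hcmp x hx.2).1,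
      measureReal_le_mul_of_density_le _ μ' μ ρ' ρ hμ' hμ (hC.inter hG) hK₂pos.le fun x hx => (hcmp x hx.2).2⟩
  -- §4 tails: the inner window has mass `≥ 1 − δ₀` under both laws
  have hGc : Gᶜ = {U | ¬ PlaqSmall θin U} := by rw [hGdef, Set.compl_setOf]
  have htailR : μ.real Gᶜ ≤ δ₀ := by
    rw [measureReal_def, hGc]
    calc (μ {U | ¬ PlaqSmall θin U}).toReal ≤ (ENNReal.ofReal ηr).toReal := ENNReal.toReal_mono ENNReal.ofReal_ne_top htail
      _ = ηr := ENNReal.toReal_ofReal hηr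
      _ ≤ δ₀ := hηrδ
  have htailR' : μ'.real Gᶜ ≤ δ₀ := by
    rw [measureReal_def, hGc]
    calc (μ' {U | ¬ PlaqSmall θin U}).toReal ≤ (ENNReal.ofReal ηr).toReal := ENNReal.toReal_mono ENNReal.ofReal_ne_top htail'
      _ = ηr := ENNReal.toReal_ofReal hηr
      _ ≤ δ₀ := hηrδ
  have hmG : 1 - δ₀ ≤ μ.real G := by
    have := measureReal_add_measureReal_compl (μ := μ) hG
    rw [probReal_univ] at this
    linarith
  have hmG' : 1 - δ₀ ≤ μ'.real G := by
    have := measureReal_add_measureReal_compl (μ := μ') hG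
    rw [probReal_univ] at this
    linarith
  have hmG1 : μ.real G ≤ 1 := measureReal_le_one
  have hmG1' : μ'.real G ≤ 1 := measureReal_le_one
  -- §5 the constants are pinned: `1 − δ₀ ≤ K₁, K₂ ≤ e^{2δ₀}/(1 − δ₀)`
  obtain ⟨hGK₁, hGK₂⟩ := hint Set.univ MeasurableSet.univ
  rw [Set.univ_inter] at hGK₁ hGK₂
  have hK₁lb : 1 - δ₀ ≤ K₁ := by
    have h1 : K₁ * μ'.real G ≤ K₁ * 1 := mul_le_mul_of_nonneg_left hmG1' hK₁pos.le
    linarith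
  have hK₂lb : 1 - δ₀ ≤ K₂ := by
    have h1 : K₂ * μ.real G ≤ K₂ * 1 := mul_le_mul_of_nonneg_left hmG1 hK₂pos.le
    linarith
  have h1δ : 0 < 1 - δ₀ := by linarith
  set M : ℝ := Real.exp (2 * δ₀) / (1 - δ₀) with hMdef
  have hK₁M : K₁ ≤ M := by
    rw [hMdef, le_div_iff₀ h1δ]
    calc K₁ * (1 - δ₀) ≤ K₁ * K₂ := mul_le_mul_of_nonneg_left hK₂lb hK₁pos.le
      _ = Real.exp (2 * δ₀) := hK₁K₂
  have hK₂M : K₂ ≤ M := by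
    rw [hMdef, le_div_iff₀ h1δ]
    calc K₂ * (1 - δ₀) ≤ K₂ * K₁ := mul_le_mul_of_nonneg_left hK₁lb hK₂pos.le
      _ = Real.exp (2 * δ₀) := by rw [mul_comm, hK₁K₂]
  have hM1 : M - 1 ≤ 10 * δ₀ := exp_two_mul_div_sub_one_le hδ₀nn hδ₀half
  have hM0 : 0 ≤ M - 1 := by
    have hexp1 : 1 ≤ Real.exp (2 * δ₀) := Real.one_le_exp (by linarith)
    have : 1 ≤ M := by
      rw [hMdef, le_div_iff₀ h1δ]
      linarith
    linarith
  -- §6 the window part of `A`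
  obtain ⟨hAK₁, hAK₂⟩ := hint A hA
  have hx1 : μ'.real (A ∩ G) ≤ 1 := measureReal_le_one
  have hy1 : μ.real (A ∩ G) ≤ 1 := measureReal_le_one
  have hx0 : 0 ≤ μ'.real (A ∩ G) := measureReal_nonneg
  have hy0 : 0 ≤ μ.real (A ∩ G) := measureReal_nonneg
  have hup : μ.real (A ∩ G) - μ'.real (A ∩ G) ≤ 10 * δ₀ := by
    have h1 : μ.real (A ∩ G) ≤ M * μ'.real (A ∩ G) := hAK₁.trans (mul_le_mul_of_nonneg_right hK₁M hx0)
    have h2 : (M - 1) * μ'.real (A ∩ G) ≤ (M - 1) * 1 := mul_le_mul_of_nonneg_left hx1 hM0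
    have h3 : M * μ'.real (A ∩ G) = (M - 1) * μ'.real (A ∩ G) + μ'.real (A ∩ G) := by ring
    linarith
  have hdown : μ'.real (A ∩ G) - μ.real (A ∩ G) ≤ 10 * δ₀ := by
    have h1 : μ'.real (A ∩ G) ≤ M * μ.real (A ∩ G) := hAK₂.trans (mul_le_mul_of_nonneg_right hK₂M hy0)
    have h2 : (M - 1) * μ.real (A ∩ G) ≤ (M - 1) * 1 := mul_le_mul_of_nonneg_left hy1 hM0
    have h3 : M * μ.real (A ∩ G) = (M - 1) * μ.real (A ∩ G) + μ.real (A ∩ G) := by ring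
    linarith
  -- §7 the tail part of `A`
  have hdiff : μ.real (A \ G) ≤ δ₀ := (measureReal_mono (Set.sdiff_subset_compl A G)).trans htailR
  have hdiff' : μ'.real (A \ G) ≤ δ₀ := (measureReal_mono (Set.sdiff_subset_compl A G)).trans htailR'
  have hd0 : 0 ≤ μ.real (A \ G) := measureReal_nonneg
  have hd0' : 0 ≤ μ'.real (A \ G) := measureReal_nonneg
  have hsplit : μ.real A = μ.real (A ∩ G) + μ.real (A \ G) := (measureReal_inter_add_sdiff (μ := μ) (s := A) hG).symm
  have hsplit' : μ'.real A = μ'.real (A ∩ G) + μ'.real (A \ G) := (measureReal_inter_add_sdiff (μ := μ') (s := A) hG).symm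
  rw [hsplit, hsplit', abs_le]
  constructor <;> linarith

end Summit.QuantumFields.YangMills.Theorems.RunPairOrganWindowTVOfSupOsc
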